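import Summits.BirchSwinnertonDyer.Rank1Residual.F1Sign2.ConductorBitSpinLawAtTwo
import HarnessLib.Audit.Tags
import HarnessLib

/-!
# Cell `bsd-f1-sign2` — descent lens (planner `-desc` g28; MEMO-desc §38 = `MEMO-desc-data/g28/memo/MEMO-desc-38.md` a4ca5862e2c89245; THM 38.1 / THM 38.2 / COR 38.3, ENGINE 39):
# DESC-38 — ON THE ODD-TAMAGAWA SLICE THE ± OBJECT AT 2 IS SWITCHED OFF: DESC-38-A `PureSpinLawOfOddTamagawaAtTwo` (`@[conjecture]`) + -desc's four glue theorems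
# (sibling of `ConductorBitSpinLawAtTwo.lean` — DESC-37, whose §37 carriers it imports — and of `CorrectedSpinLawAtTwo.lean` — LAW36 / DESC-36)

STATEMENTS + -desc's glue theorems (typer -ty g20).  Source: `HOME/MEMO-desc-data/g28/lean/Sketch38.lean` **7bbec4ff25db1930** (96 l.; -desc STATUS 2026-08-29T20:20:19Z DONE: farm
rc 0), lines 19–96 VERBATIM from `noncomputable section` to the final `end` (= head of REF1's `Probe246.lean` 9860375b038b68ea; frozen copy in the typer's kit; builder-verified line by
line); typer edits = this header and one «RIDER» paragraph appended to the row docstring.  PORT GATE = REF1-AUDIT §246 (-ref1 g22, 2026-08-29T20:30:25Z; `REF1-data/b246/`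
Probe246.lean → check246.json rc 0, 1 sorry = the A1 probe; -desc's glue theorems sorry-free): **DESC-38-A SURVIVES — honest `@[conjecture]`, theorem-candidate modulo LAW36′
(DESC-36-E's dictionary) exactly as -desc says; THM 38.1 / THM 38.2 correct, COROLLARY-OF-PRINT (Milne ADT I.3.8 + Kummer sequence; Néron-component criterion); 0 KILLED.**
A2: the row is EXACTLY DESC-37-B (§234) with the three 2-adic binders (`BInvariantsZ`, `OneTwoAdicRoot`, `¬ ConductorOddAboveTwo`) and the place-wise «∀ odd v, Odd c_v» REPLACED by
the single crux binder `Odd W.tamagawaProduct` (verbatim the hypothesis of `RankOneAtTwoBigImageOddLocal`); conclusion identical (pure law, empty correction list).  Junk/polarity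
(BC7-b, kernel sibling): `tamagawaProduct` is a `finprod`, `= 1` (odd!) if the support were infinite — that would make the hypothesis free and the row STRONGER, not vacuous; -desc's
kernel lemma `odd_tamagawaNumberAt_of_odd_tamagawaProduct` rightly carries `(mulSupport …).Finite` to pass from the product to each `c_v`.  THM 38.1/38.2 re-derived by REF1 (six
lines: `H¹(K^nr/K, W⁰(K^nr)) = 0` (Lang + Hensel) ⟹ `H¹(K^nr/K, W(K^nr)) ↪ H¹(k, Φ_v) = Φ/(F−1)Φ` of order `c_v`; an unramified class maps to `H¹(K^nr/K, W(K^nr))[p] = 0` when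
`p ∤ c_v`, so it is Kummer ✓; in general `ξ = [T] ↦ [c̄(T)]`, so `H¹_nr ⊄ Im δ ⟺ ∃ T ∈ W[p](K^nr)` with `c̄(T) ∉ (F−1)Φ(k̄)` ✓).  BC7 (independent engine, `d₂ = 1`, REF1 §242's exact 2-adic
`q2engine` × -desc's ENGINE 39 rows): `(c₂ parity, 𝒲₂ ⊂ 𝒰₂)`: (odd, ⊂) 49 · (even, ⊂) 23 · (even, ⊄) 23 — **`c₂` odd ⟹ `𝒲₂ ⊂ 𝒰₂`: 0 violations / 49**; ENGINE 39's switch vs REF1: `u₂ = 1 ⟺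
𝒲₂ ⊄ 𝒰₂` on 95/95.  RIDERS: R246a (wording): `𝒰₂` denotes the UNIT classes (= `(H¹_nr)^⊥`), not the unramified Kummer classes (= `H¹_nr = 𝒰₂^⊥`) — the inclusion `𝒲₂ ⊂ 𝒰₂` is only
meaningful for the former; R246b (thin cell): the new content of DESC-38-A beyond DESC-37-B is `d₂ ∈ {0, 2}` — 12 curves / 500 pure primes, of which `d₂ = 2` only 2 curves (93
primes); cheapest next falsifier = odd-Tamagawa, `h_L`-odd, `d₂ = 2` curves in quantity; R246c: `selmerTwoCard W = 1` + rank considerations as in LAW36 (§224/§234).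
REF2 PLACEMENT (INBOX 2026-08-29T20:21:32Z): THM 38.2 = COROLLARY-OF-PRINT of Česnavičius 2016 (J. Ramanujan Math. Soc. 31; arXiv 1301.4724) Prop. 2.5(a) — for `A/K` with
semiabelian reduction and `char k ∣ deg φ`, `#(H¹(𝒪, 𝒜[φ]) / (H¹(𝒪, 𝒜[φ]) ∩ Im κ_φ)) = #Φ_A(k) / #(φ(Φ_A))(k)` (an EXACT index); for `v ∤ 2`, `H¹_fppf(𝒪_v, 𝒲[2]) = H¹_nr(K_v, W[2])`, so
`u_v = [#Φ_v(k) > #(2Φ_v)(k)]` and -desc's rule table is (a) evaluated type by type (REF2 checked Z0 / ZF1 / V1 / ZFm1: `u = [n ≡ 2 (mod 4)]` for `Φ(k̄) = ℤ/n`, `F = −1`); at `v = 2`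
with ADDITIVE reduction (a)'s semiabelian hypothesis fails and the Milne-route statement is the right one (no printed evaluation found; Milne ADT I.3.8 + Česnavičius (a) for the
semistable case); THM 38.1 cites CONCUR (Česnavičius 2.5(c) + Milne I.3.8).  PARTITION (REF2): THM 38.1/38.2 corollary-of-print CONFIRMED (38.2's `v`-odd table = print; `v = 2`
additive rows = routine beyond print); DESC-38-A conjecture-grade (beyond print, as LAW36).  REF2's suggested Literature fact «`integralClasses_mod_kummer_card_eq_componentIndex`
[Česnavičius 2016, Prop. 2.5(a)]» needs fppf cohomology of the Néron model's torsion — not in the tree; recorded for a later Literature port, not typed here.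

ROW.  **DESC-38-A `PureSpinLawOfOddTamagawaAtTwo`** (`@[conjecture]`): LAW36 setting (`CubicDatumFor`, `Sel₂(W) = 0` as `selmerTwoCard W = 1`, `DegOnePrimesOddClassC`) + `Odd
W.tamagawaProduct` ⟹ `CorrectedSpinLawFits W c xnum xden []` — for EVERY 2-adic type `d₂ ∈ {0, 1, 2}` and every Kodaira symbol at 2 (no Hensel datum, no 𝔯-bit); at `d₂ = 1` it
is ⊂ DESC-37-B (`c₂` odd ⟹ 𝔯 even by THM 38.1 + LEMMA 37.L); glue: `shapeWitness_nil_of_oddTamagawa` (⊂ DESC-36-E with `ys = []`), `odd_tamagawaNumberAt_of_odd_tamagawaProduct` /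
`oddPlaces_of_odd_tamagawaProduct` (product odd ⟹ every `c_v` odd, given finite support), `pureLaw_of_either` (§37/§38 rows shape-compatible).
DATA = BC5 WITNESS (MEMO-desc §38.3, `MEMO-desc-data/g28/an/check38.txt` 20df18ca4f2f29be + an/slice38.txt; CENSUS36.tsv 5cd6e3bc794dc87a × tam38 j334815 × e38 j334852 × e39
j335565; numbers not adjectives): `c₂` odd ⟹ `W2inU2 = 1`: **110/110** (d₂ = 0: 58, d₂ = 1: 49, d₂ = 2: 3); THM 38.2's switch, two engines 174/174 + 317/317; the valid (`h_L`-odd) census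
curves with ODD Tamagawa product are **38** (d₂ = 0: 10, d₂ = 1: 26, d₂ = 2: 2; Kodaira at 2: I₀ ×10, I₁ ×3, I₃ c1, I₃ c3, I₇ c7, II ×6, II* ×5, IV c1 ×6, IV c3, IV* c3, I₀* c1 ×3; `h_L = 1`
×37, `3` ×1; all `Δ_L < 0`), with **38 census runs, 1618 pure split primes, `ys = []` in EVERY run** (REF1 re-derived 38 / 38 / 1618 from the raw files to the digit), every place `u_v = 0`;
12 of them (500 pure primes) lie outside every §37 row.  CHEAPEST FALSIFIER (run): «an odd-Tamagawa-product, `h_L`-odd census curve with a run having `ys ≠ []`» — **0 of 38**.  CONTROL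
(an/harmless38.txt): of the 120 EVEN-product curves with runs, 55 need a correction and 65 are pure — purity is NOT «odd Tamagawa»; the exact statement one level up («`u_v = 0` at every
place ⟹ pure») holds 79/79 (DESC-38-B for -desc g29, informal; not typed).  Why it might fail (-desc): only through LAW36′ itself or an even class number (excluded); `c_v` odd is
sufficient, not necessary, for harmlessness.
PARTITION: none moved (DESC-38-A conjecture-grade beyond print; THM 38.1/38.2 corollary-of-print).  Beyond-print theorem: no.  BSD is not proved by this; 23715 is not closed.
bears_on: stmt-BirchSwinnertonDyer-23715 (the binder `Odd W.tamagawaProduct` of crux `RankOneAtTwoBigImageOddLocal`, verbatim).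
-/

noncomputable section

open scoped Classical

open WeierstrassCurve Literature.NumberTheory.EllipticCurves Polynomial IsDedekindDomain NumberField

namespace Summit.BirchSwinnertonDyer.Rank1Residual.F1Sign2

/-! ### §38 row -/

/-- **DESC-38-A `PureSpinLawOfOddTamagawaAtTwo` (THE ODD-TAMAGAWA SLICE IS PURE; `@[conjecture]`, theorem-candidate modulo LAW36′ = DESC-36-E's
Poitou–Tate dictionary; MEMO-desc §38.3).**  Setting of LAW36 (`CubicDatumFor`, `Sel₂(W) = 0`, every degree-one prime of `ℤ[X]/(c)` of odd class order).
If the Tamagawa product `∏_v c_v(W)` is ODD then the PURE `S₃`-spin law fits with the empty correction list: at every pure split prime of every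
genus-class-trivial twist member, `κ(p) = 1 ⟺ spin bit`.  Mechanism (THM 38.1): `2 ∤ c_v` puts the unramified classes `H¹_nr(ℚ_v, W[2])` inside the Kummer
image at EVERY place (`H¹(ℚ_v^nr/ℚ_v, W(ℚ_v^nr)) ≅ H¹(k, Φ_v)` has order `c_v`), hence `𝒲_v ⊂ 𝒰_v` everywhere (at 2 because `𝒰₂ = (H¹_nr)^⊥` and `𝒲₂` is
Lagrangian), hence (P37.1, Poitou–Tate) every LAW36 cofactor has even valuations, hence (odd class number) is a unit times a square, hence the correction
class vanishes at pure primes.  No 2-adic type hypothesis: `d₂ ∈ {0,1,2}`, any Kodaira symbol with odd `c₂` (good, I_{2k+1}, nonsplit I_n, II, II*, IV, IV*,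
I₀* with `c₂ ∈ {1}`, IV/IV* with `c₂ = 3`).  Why it might fail: only through LAW36′ itself (the dictionary «visible places = support of the correction») or an
even class number (excluded); `c_v` odd is sufficient, not necessary, for harmlessness (split-nonsplit I₄/I₈, I_{2k+1}* with `c = 2` are harmless with even `c`).
BC5 (MEMO-desc §38.3, an/check38.txt): the census curves with odd Tamagawa product and `h_L` odd ALL have `ys = []` in every CENSUS36 run (numbers in the memo);
cheapest falsifier RUN: «such a curve with a run having `ys ≠ []`» — none.
(RIDER, typer -ty g20: `@[conjecture]` as audited.  REF1-AUDIT §246: **SURVIVES** — honest conjecture, theorem-candidate modulo LAW36′ (DESC-36-E's Poitou–Tate dictionary);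
= DESC-37-B `PureSpinLawOfLoneEvenConductorAtTwo` with the three 2-adic binders and the place-wise odd-`c_v` clause REPLACED by the single crux binder `Odd W.tamagawaProduct`
(kernel glue `oddPlaces_of_odd_tamagawaProduct` recovers the place-wise clause given finite support; BC7-b: without finiteness `finprod = 1` is odd — the row gets STRONGER, not
vacuous); R246a: in this docstring `𝒰₂` = the UNIT classes `(H¹_nr)^⊥`, not the unramified Kummer classes `H¹_nr = 𝒰₂^⊥`; R246b: the content beyond DESC-37-B is the thin cell
`d₂ ∈ {0, 2}` (12 curves / 500 pure primes; `d₂ = 2`: 2 curves, 93 primes) — next falsifier: odd-Tamagawa, `h_L`-odd, `d₂ = 2` curves in quantity.  BC5 (MEMO-desc §38.3; REF1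
bc5_246.out re-derived to the digit): 38 odd-Tamagawa-product `h_L`-odd census curves, 38 runs, 1618 pure split primes, `ys = []` in 38/38; falsifier run 0/38; BC7 (REF1 §242
engine × ENGINE 39, `d₂ = 1`): `c₂` odd ⟹ `𝒲₂ ⊂ 𝒰₂` 0 violations / 49, switch agreement 95/95.  REF2 (INBOX 20:21:32Z): THM 38.1/38.2 behind the mechanism = COROLLARY-OF-PRINT
(Milne ADT I.3.8; Česnavičius 2016 Prop. 2.5(a)/(c), arXiv 1301.4724 p. 6); this row conjecture-grade beyond print, as LAW36.) -/
@[conjecture] def PureSpinLawOfOddTamagawaAtTwo : Prop :=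
  ∀ (W : WeierstrassCurve ℚ) [W.IsElliptic] [W.IsGloballyMinimal],
    ∀ (c xnum : ℤ[X]) (xden : ℕ), CubicDatumFor W c xnum xden →
      selmerTwoCard W = 1 → DegOnePrimesOddClassC c → Odd W.tamagawaProduct →
        CorrectedSpinLawFits W c xnum xden []

/-! ### kernel glue -/

/-- Kernel glue: on a DESC-38-A curve LAW36-shape (DESC-36-E `GenusTrivialTwistCorrectedSpinLawShape`) holds with the EMPTY list — DESC-38-A is the
`ys = []` sub-case of DESC-36-E on the odd-Tamagawa slice. -/
theorem shapeWitness_nil_of_oddTamagawa (h : PureSpinLawOfOddTamagawaAtTwo)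
    (W : WeierstrassCurve ℚ) [W.IsElliptic] [W.IsGloballyMinimal] (c xnum : ℤ[X]) (xden : ℕ)
    (hc : CubicDatumFor W c xnum xden) (hs : selmerTwoCard W = 1) (ho : DegOnePrimesOddClassC c) (ht : Odd W.tamagawaProduct) :
    ∃ ys : List ℤ[X], (∀ y ∈ ys, CorrectionElementC W c y) ∧ ys.length ≤ 3 * (W.conductorNorm ℤ).primeFactors.card ∧
      CorrectedSpinLawFits W c xnum xden ys :=
  ⟨[], by simp, by simp, h W c xnum xden hc hs ho ht⟩

/-- Kernel lemma (links the DESC-38-A binder to DESC-37-B's place-wise clause): if the Tamagawa product is odd then EVERY local Tamagawa number is odd —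
given finiteness of the set of places with `c_v ≠ 1` (the content of the named fact `mulSupport_localTamagawaNumber_finite`; without it the `finprod`
has junk value `1`). -/
theorem odd_tamagawaNumberAt_of_odd_tamagawaProduct (W : WeierstrassCurve ℚ)
    (hfin : (Function.mulSupport fun v : HeightOneSpectrum (𝓞 ℚ) => W.tamagawaNumberAt v).Finite)
    (hodd : Odd W.tamagawaProduct) (v : HeightOneSpectrum (𝓞 ℚ)) : Odd (W.tamagawaNumberAt v) := by
  classical
  have hprod : W.tamagawaProduct = ∏ u ∈ hfin.toFinset, W.tamagawaNumberAt u := by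
    rw [WeierstrassCurve.tamagawaProduct]
    exact finprod_eq_prod_of_mulSupport_subset _ (by intro u hu; simpa using hu)
  by_cases hv : v ∈ Function.mulSupport fun v : HeightOneSpectrum (𝓞 ℚ) => W.tamagawaNumberAt v
  · have hdvd : W.tamagawaNumberAt v ∣ W.tamagawaProduct := by
      rw [hprod]; exact Finset.dvd_prod_of_mem _ (hfin.mem_toFinset.mpr hv)
    exact hodd.of_dvd_nat hdvd
  · have h1 : W.tamagawaNumberAt v = 1 := by simpa [Function.mem_mulSupport] using hv
    rw [h1]; exact odd_one

/-- Kernel glue: under the finiteness fact, the DESC-38-A hypothesis implies DESC-37-B's «every ODD place has odd Tamagawa number» (so on `d₂ = 1`, 𝔯-even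
curves DESC-38-A's conclusion is already DESC-37-B's; DESC-38-A is new at `d₂ ∈ {0, 2}` and states no 2-adic hypothesis at all). -/
theorem oddPlaces_of_odd_tamagawaProduct (W : WeierstrassCurve ℚ)
    (hfin : (Function.mulSupport fun v : HeightOneSpectrum (𝓞 ℚ) => W.tamagawaNumberAt v).Finite) (hodd : Odd W.tamagawaProduct) :
    ∀ v : HeightOneSpectrum (𝓞 ℚ), (2 : 𝓞 ℚ) ∉ v.asIdeal → Odd (W.tamagawaNumberAt v) :=
  fun v _ => odd_tamagawaNumberAt_of_odd_tamagawaProduct W hfin hodd v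

/-- Kernel glue: DESC-37-B and DESC-38-A give the same conclusion shape, so on a curve satisfying both hypothesis sets either row yields the pure law
(sanity that the §37/§38 rows are shape-compatible). -/
theorem pureLaw_of_either (h38 : PureSpinLawOfOddTamagawaAtTwo)
    (W : WeierstrassCurve ℚ) [W.IsElliptic] [W.IsGloballyMinimal] (c xnum : ℤ[X]) (xden : ℕ)
    (hc : CubicDatumFor W c xnum xden) (hs : selmerTwoCard W = 1) (ho : DegOnePrimesOddClassC c)
    (h : Odd W.tamagawaProduct ∨ (PureSpinLawOfLoneEvenConductorAtTwo ∧ ∃ B2 B4 B6 : ℤ, BInvariantsZ W B2 B4 B6 ∧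
        (∀ v : HeightOneSpectrum (𝓞 ℚ), (2 : 𝓞 ℚ) ∉ v.asIdeal → Odd (W.tamagawaNumberAt v)) ∧
        OneTwoAdicRoot (twoDivisionCubicZ B2 B4 B6) ∧ ¬ ConductorOddAboveTwo (twoDivisionCubicZ B2 B4 B6))) :
    CorrectedSpinLawFits W c xnum xden [] := by
  rcases h with ht | ⟨h37, B2, B4, B6, hb, ht, h1, h0⟩
  · exact h38 W c xnum xden hc hs ho ht
  · exact h37 W c xnum xden B2 B4 B6 hc hb hs ho ht h1 h0

end Summit.BirchSwinnertonDyer.Rank1Residual.F1Sign2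

end
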